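import Summits.CriticalPhenomena.PercolationContinuityZ3.Theorems.PercNearOneGluingNoHeavyLowerTailSahiTangentPatternTwoCheck

/-!
# `NoHeavyLowerTail` (crux stmt-CriticalPhenomena-4575), Sahi programme: the tangent pattern inequality in dimension two,
# part 3 — **CONJECTURE T₃ ON EVERY TWO-DIMENSIONAL GRID × COIN** (product weights), and `TangentPatternPos d` for `d ≤ 2`

Support file (Sahi cell, seat `prim-sahi-p1`, generation 48; `--supports stmt-CriticalPhenomena-4575`).  Pure proofs, no definitions, no
`sorry`.  `sStarT_liftSet`, `tangentPatternPos_anti`, `tangentPatternPos_of_le` are kernel theorems with standard axioms; everything tagged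
[computational] inherits the single `native_decide` evaluation `checkTPP2_eq_true` of part 2 (`…SahiTangentPatternTwoCheck`).

THE RESULTS.
* `sStarT_liftSet`: lifting the three pairs from `[3]^d` to `[3]^{d+1}` (ignore the last coordinate) multiplies the tangent pattern functional
  by `6`; hence `tangentPatternPos_anti : TangentPatternPos (d+1) → TangentPatternPos d`, `tangentPatternPos_of_le`, and with part 2
  **`tangentPatternPos_of_le_two : d ≤ 2 → TangentPatternPos d`** (so also `d = 0, 1`; `d = 4` is FALSE, `…SahiTangentPatternFour`; `d = 3` open).
* **`tangentForm_gridProd_nonneg_of_le_two`**: for `d ≤ 2`, every nonnegative product weight on the grid `[K+1]^d` and all triples of pairs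
  `B_i ⊆ T_i` of up-sets, the homogeneous tangent form is `≥ 0` — `Z³·T₃` has nonnegative coefficients in the chain weights.
* **`tangentExpr_nonneg_grid_of_le_two`**: the 14-term tangent expression `T₃ = E₃(1) − E₃′(1)` of `…SahiTangentChain` is `≥ 0` for every
  product probability weight on `[K+1]^d`, `d ≤ 2`, and up-sets `U₀ ⊆ U₁`, `V₀ ⊆ V₁`, `W₀ ⊆ W₁`.
* **`sahiE_three_coin_grid_ge_of_le_two`** — CONJECTURE T₃ (memo FROM-prim-sahi-p2-gen32-TANGENT §0(2)) ON EVERY GRID OF DIMENSION `≤ 2`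
  × COIN, PRODUCT WEIGHTS, in contraction form: for `μ = ⊗_a g_a` a product probability weight on `[K+1]^d` (`d ≤ 2`), `p ∈ [0,1]` and pairs
  of up-sets, `p · E₃^{μ}(χ_{U₁},χ_{V₁},χ_{W₁}) ≤ E₃^{B_p⊗μ}(F_U,F_V,F_W)` where `F_U(ε,x) = (ε ? χ_{U₁} x : χ_{U₀} x)`.
  For `d = 1` this is (the product-weight case of) `SahiTangent.sahiE_coin_chain_ge` at `n = 3` / p2's `sahiE_three_coin_chain_ge`, which
  hold for ALL weights on a chain; `d = 2` is NEW: the first class beyond chains on which the tangent / contraction inequality is a theorem.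
  By `…SahiTangentPatternFour` / census W161 the same statement FAILS on `{0,1}⁴ × coin` (product measures), so `d ≤ 2` here cannot be
  replaced by all `d`; `d = 3` (e.g. `{0,1}³ × coin`: true by p2's certificates `…SahiTangentCubeThree`) is open for general 3-grids.
HONEST LABEL: computational (one `native_decide`, part 2). [this work]
-/

namespace Summit.CriticalPhenomena.PercolationContinuityZ3.Theorems.SahiTangent

open Finset Literature.Probability.LatticeModels Literature.Combinatorics.Sahi2008
open SahiGrid3 (ind)
open SahiGridPattern (Pd Xd col liftSet ind_liftSet isUpperSet_liftSet)
open scoped BigOperators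

noncomputable section

/-! ### Monotonicity of `TangentPatternPos` in the dimension -/

section Lift

variable {d : ℕ}

/-- **`sStarT` of lifted pairs**: `sStarT (lift T) (lift B) = 6 · sStarT T B`. [this work] -/
theorem sStarT_liftSet (T B : Fin 3 → Finset (Pd d)) :
    sStarT (fun i => liftSet (T i)) (fun i => liftSet (B i)) = 6 * sStarT T B := by
  unfold sStarT
  rw [← (Fin.snocEquiv fun _ : Fin (d + 1) => Equiv.Perm (Fin 3)).sum_comp, Fintype.sum_prod_type]
  have h : ∀ (e : Equiv.Perm (Fin 3)) (π : Fin d → Equiv.Perm (Fin 3)) (c : Fin 3),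
      Fin.init (col ((Fin.snocEquiv fun _ : Fin (d + 1) => Equiv.Perm (Fin 3)) (e, π)) c) = col π c := by
    intro e π c
    funext a
    show (Fin.snocEquiv (fun _ : Fin (d + 1) => Equiv.Perm (Fin 3)) (e, π)) (Fin.castSucc a) c = π a c
    simp [Fin.snocEquiv]
  have h6 : Fintype.card (Equiv.Perm (Fin 3)) = 6 := by
    rw [Fintype.card_perm, Fintype.card_fin]; rfl
  simp only [tker, ind_liftSet, h]
  rw [Finset.sum_const, Finset.card_univ, h6, nsmul_eq_mul, Nat.cast_ofNat]

/-- **`TangentPatternPos` is antitone in the dimension**: `TangentPatternPos (d+1) → TangentPatternPos d`. [this work] -/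
theorem tangentPatternPos_anti (h : TangentPatternPos (d + 1)) : TangentPatternPos d := by
  intro T B hT hB hBT
  have h6 := h (fun i => liftSet (T i)) (fun i => liftSet (B i)) (fun i => isUpperSet_liftSet (hT i))
    (fun i => isUpperSet_liftSet (hB i)) (fun i => by
      intro q hq
      unfold liftSet at hq ⊢
      rw [mem_filter] at hq ⊢
      exact ⟨hq.1, hBT i hq.2⟩)
  rw [sStarT_liftSet] at h6
  omega

/-- `TangentPatternPos` descends along `≤`. [this work] -/
theorem tangentPatternPos_of_le {d d' : ℕ} (hdd' : d ≤ d') (h : TangentPatternPos d') : TangentPatternPos d := by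
  induction d' with
  | zero => rwa [Nat.le_zero.1 hdd']
  | succ n ih =>
    rcases Nat.lt_or_eq_of_le hdd' with hlt | rfl
    · exact ih (Nat.lt_succ_iff.1 hlt) (tangentPatternPos_anti h)
    · exact h

/-- **`TangentPatternPos d` for every `d ≤ 2`** (COMPUTATIONAL: part 2's `tangentPatternPos_two`). [this work] [computational] -/
theorem tangentPatternPos_of_le_two (hd : d ≤ 2) : TangentPatternPos d :=
  tangentPatternPos_of_le hd tangentPatternPos_two

end Lift

/-! ### Conjecture T₃ on grids of dimension `≤ 2` × coin, product weights -/

section Grid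

variable {d K : ℕ}

/-- **The tangent form is nonnegative on every grid of dimension `≤ 2`**, for every nonnegative product weight and all triples of pairs
`B_i ⊆ T_i` of up-sets: `Z³·T₃` is coefficientwise nonnegative in the chain weights. [this work] [computational] -/
theorem tangentForm_gridProd_nonneg_of_le_two (hd : d ≤ 2) (g : Fin d → Fin (K + 1) → ℝ) (hg : ∀ a u, 0 ≤ g a u)
    {T B : Fin 3 → Finset (Xd d K)} (hT : ∀ i, IsUpperSet (T i : Set (Xd d K))) (hB : ∀ i, IsUpperSet (B i : Set (Xd d K)))
    (hBT : ∀ i, B i ⊆ T i) : 0 ≤ tangentForm (fun ω : Xd d K => ∏ a, g a (ω a)) T B :=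
  tangentForm_gridProd_nonneg_of (tangentPatternPos_of_le_two hd) g hg hT hB hBT

/-- **`T₃ ≥ 0` on every grid of dimension `≤ 2`** (the 14-term tangent expression of `…SahiTangentChain`), for every product probability
weight and up-sets `U₀ ⊆ U₁`, `V₀ ⊆ V₁`, `W₀ ⊆ W₁`. [this work] [computational] -/
theorem tangentExpr_nonneg_grid_of_le_two (hd : d ≤ 2) (g : Fin d → Fin (K + 1) → ℝ) (hg0 : ∀ a u, 0 ≤ g a u)
    (hg1 : ∀ a, ∑ u, g a u = 1) {U₀ U₁ V₀ V₁ W₀ W₁ : Finset (Xd d K)}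
    (hU₀ : IsUpperSet (U₀ : Set (Xd d K))) (hU₁ : IsUpperSet (U₁ : Set (Xd d K))) (hV₀ : IsUpperSet (V₀ : Set (Xd d K)))
    (hV₁ : IsUpperSet (V₁ : Set (Xd d K))) (hW₀ : IsUpperSet (W₀ : Set (Xd d K))) (hW₁ : IsUpperSet (W₁ : Set (Xd d K)))
    (hU : U₀ ⊆ U₁) (hV : V₀ ⊆ V₁) (hW : W₀ ⊆ W₁) :
    0 ≤ 2 * ex (fun ω : Xd d K => ∏ a, g a (ω a)) (setInd U₀ * setInd V₀ * setInd W₀)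
        + (ex (fun ω : Xd d K => ∏ a, g a (ω a)) (setInd U₁) - ex (fun ω : Xd d K => ∏ a, g a (ω a)) (setInd U₀))
            * ex (fun ω : Xd d K => ∏ a, g a (ω a)) (setInd V₁ * setInd W₁)
        + (ex (fun ω : Xd d K => ∏ a, g a (ω a)) (setInd V₁) - ex (fun ω : Xd d K => ∏ a, g a (ω a)) (setInd V₀))
            * ex (fun ω : Xd d K => ∏ a, g a (ω a)) (setInd U₁ * setInd W₁)
        + (ex (fun ω : Xd d K => ∏ a, g a (ω a)) (setInd W₁) - ex (fun ω : Xd d K => ∏ a, g a (ω a)) (setInd W₀))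
            * ex (fun ω : Xd d K => ∏ a, g a (ω a)) (setInd U₁ * setInd V₁)
        + ex (fun ω : Xd d K => ∏ a, g a (ω a)) (setInd U₀) * ex (fun ω : Xd d K => ∏ a, g a (ω a)) (setInd V₁)
            * ex (fun ω : Xd d K => ∏ a, g a (ω a)) (setInd W₁)
        + ex (fun ω : Xd d K => ∏ a, g a (ω a)) (setInd V₀) * ex (fun ω : Xd d K => ∏ a, g a (ω a)) (setInd U₁)
            * ex (fun ω : Xd d K => ∏ a, g a (ω a)) (setInd W₁)
        + ex (fun ω : Xd d K => ∏ a, g a (ω a)) (setInd W₀) * ex (fun ω : Xd d K => ∏ a, g a (ω a)) (setInd U₁)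
            * ex (fun ω : Xd d K => ∏ a, g a (ω a)) (setInd V₁)
        - ex (fun ω : Xd d K => ∏ a, g a (ω a)) (setInd U₁) * ex (fun ω : Xd d K => ∏ a, g a (ω a)) (setInd V₀ * setInd W₀)
        - ex (fun ω : Xd d K => ∏ a, g a (ω a)) (setInd V₁) * ex (fun ω : Xd d K => ∏ a, g a (ω a)) (setInd U₀ * setInd W₀)
        - ex (fun ω : Xd d K => ∏ a, g a (ω a)) (setInd W₁) * ex (fun ω : Xd d K => ∏ a, g a (ω a)) (setInd U₀ * setInd V₀)
        - 2 * ex (fun ω : Xd d K => ∏ a, g a (ω a)) (setInd U₁) * ex (fun ω : Xd d K => ∏ a, g a (ω a)) (setInd V₁)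
            * ex (fun ω : Xd d K => ∏ a, g a (ω a)) (setInd W₁) :=
  tangentExpr_nonneg_grid_of_tpp (tangentPatternPos_of_le_two hd) g hg0 hg1 hU₀ hU₁ hV₀ hV₁ hW₀ hW₁ hU hV hW

/-- **CONJECTURE T₃ ON EVERY GRID OF DIMENSION `≤ 2` × COIN, PRODUCT WEIGHTS — the contraction inequality.**  For nonnegative
probability chain weights `g_a` on the axes of `[K+1]^d`, `d ≤ 2`, `μ = ⊗ g_a`, `p ∈ [0,1]` and up-sets `U₀ ⊆ U₁`, `V₀ ⊆ V₁`,
`W₀ ⊆ W₁` of the grid: `p · E₃^{μ}(χ_{U₁},χ_{V₁},χ_{W₁}) ≤ E₃^{B_p⊗μ}(F_U,F_V,F_W)`; equivalently `p ↦ E₃^{B_p⊗μ}(F)/p` is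
non-increasing on `(0,1]`, and `T₃ = E₃(1) − E₃′(1) ≥ 0`.  `d = 2` is the first class beyond chains (p2 gen 32 / p1 gen 47) on which
this holds as a theorem; it fails on `{0,1}⁴ × coin` (`…SahiTangentPatternFour`). [this work] [computational] -/
theorem sahiE_three_coin_grid_ge_of_le_two (hd : d ≤ 2) (g : Fin d → Fin (K + 1) → ℝ) (hg0 : ∀ a u, 0 ≤ g a u)
    (hg1 : ∀ a, ∑ u, g a u = 1) {p : ℝ} (hp₀ : 0 ≤ p) (hp₁ : p ≤ 1) {U₀ U₁ V₀ V₁ W₀ W₁ : Finset (Xd d K)}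
    (hU₀ : IsUpperSet (U₀ : Set (Xd d K))) (hU₁ : IsUpperSet (U₁ : Set (Xd d K))) (hV₀ : IsUpperSet (V₀ : Set (Xd d K)))
    (hV₁ : IsUpperSet (V₁ : Set (Xd d K))) (hW₀ : IsUpperSet (W₀ : Set (Xd d K))) (hW₁ : IsUpperSet (W₁ : Set (Xd d K)))
    (hU : U₀ ⊆ U₁) (hV : V₀ ⊆ V₁) (hW : W₀ ⊆ W₁) :
    p * sahiE (fun ω : Xd d K => ∏ a, g a (ω a)) 3 ![setInd U₁, setInd V₁, setInd W₁] ≤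
      sahiE (fun z : Bool × Xd d K => if z.1 then p * (∏ a, g a (z.2 a)) else (1 - p) * (∏ a, g a (z.2 a))) 3
        ![fun z => if z.1 then setInd U₁ z.2 else setInd U₀ z.2, fun z => if z.1 then setInd V₁ z.2 else setInd V₀ z.2,
          fun z => if z.1 then setInd W₁ z.2 else setInd W₀ z.2] :=
  sahiE_three_coin_grid_ge_of_tpp (tangentPatternPos_of_le_two hd) g hg0 hg1 hp₀ hp₁ hU₀ hU₁ hV₀ hV₁ hW₀ hW₁ hU hV hW

/-- **The two-dimensional case, spelled out**: for every product probability weight `g₀ ⊗ g₁` on `[K+1]²`, every `p ∈ [0,1]` and pairs of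
up-sets, `p · E₃^{μ}(tops) ≤ E₃^{B_p⊗μ}(F)`. [this work] [computational] -/
theorem sahiE_three_coin_grid_two_ge (g : Fin 2 → Fin (K + 1) → ℝ) (hg0 : ∀ a u, 0 ≤ g a u) (hg1 : ∀ a, ∑ u, g a u = 1)
    {p : ℝ} (hp₀ : 0 ≤ p) (hp₁ : p ≤ 1) {U₀ U₁ V₀ V₁ W₀ W₁ : Finset (Xd 2 K)}
    (hU₀ : IsUpperSet (U₀ : Set (Xd 2 K))) (hU₁ : IsUpperSet (U₁ : Set (Xd 2 K))) (hV₀ : IsUpperSet (V₀ : Set (Xd 2 K)))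
    (hV₁ : IsUpperSet (V₁ : Set (Xd 2 K))) (hW₀ : IsUpperSet (W₀ : Set (Xd 2 K))) (hW₁ : IsUpperSet (W₁ : Set (Xd 2 K)))
    (hU : U₀ ⊆ U₁) (hV : V₀ ⊆ V₁) (hW : W₀ ⊆ W₁) :
    p * sahiE (fun ω : Xd 2 K => ∏ a, g a (ω a)) 3 ![setInd U₁, setInd V₁, setInd W₁] ≤
      sahiE (fun z : Bool × Xd 2 K => if z.1 then p * (∏ a, g a (z.2 a)) else (1 - p) * (∏ a, g a (z.2 a))) 3
        ![fun z => if z.1 then setInd U₁ z.2 else setInd U₀ z.2, fun z => if z.1 then setInd V₁ z.2 else setInd V₀ z.2,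
          fun z => if z.1 then setInd W₁ z.2 else setInd W₀ z.2] :=
  sahiE_three_coin_grid_ge_of_le_two le_rfl g hg0 hg1 hp₀ hp₁ hU₀ hU₁ hV₀ hV₁ hW₀ hW₁ hU hV hW

end Grid

end

end Summit.CriticalPhenomena.PercolationContinuityZ3.Theorems.SahiTangent
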